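import Literature.Geometry.ComplexHyperbolic.UnitBallLieAlgebraOrbitalSmooth   -- ★ (a1) p846487: `norm_22_sq_le_of_apply_conj_torusH_ne_zero`, `torusH`; brings ★ (a0), ★ `isCompact_setOf_norm_22_sq_le`
import Literature.NumberTheory.Automorphic.ArchRootSubgroupJetIntegral         -- ★ A-p18 (g26): `integral_curveJets_eq_zero` (any `S ≤ GL_N(ℂ)`), block boosts ∕ rotations and their jets (★ `ArchUnitaryRootSubgroups`)
import HarnessLib

/-!
# Right-invariance kills the root-subgroup jets of the LIE-ALGEBRA orbital integral of `U(2,1)`: `∫ [D²f(Ad_h H)(Ad_h[X,H])² + Df(Ad_h H)(Ad_h(±(PH+HP) − 2XHX))] dμ(h) = 0` at `H = torusH θ`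
# (ROAD «A6-IV» brick (a1′) = the integration-by-parts input of the flat Casimir identity (b1); Varadarajan 1989 §6.3; Warner II §8.4.1; Harish-Chandra 1957)

Topic `Geometry/ComplexHyperbolic`; namespace `Literature.Geometry.ComplexHyperbolic.BallModel`.  THEOREMS ONLY (no `def`, no instance, no notation, no axiom, no named fact, no `sorry`).
Cell `pub/hodgecm-mathlib`, ENGINE T1 (crux H413 = `stmt-HodgeConjecture-24833`); ROAD A, design of record `DESIGN-A6-InHouse-v2-ArchitectureIV` 93542b84 (LEAD T11-4), SPEC fb65bd65 (a1)
«IBP»; author F0P3a-p05 (g15) (ROAD A owner), 2026-09-01.  This file is A-p18 (g26)'s ★ `ArchRootSubgroupJetIntegral` §2–§3 (block boosts∕rotations in `G_w`, jets at a regular torus POINT of the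
GROUP) transported VERBATIM to the ball model `U21` and to a point `H = torusH θ` of the LIE ALGEBRA off the noncompact walls — ★ §1 `integral_curveJets_eq_zero` is abstract in the subgroup
`S ≤ GL_N(ℂ)` and in the conjugated matrix `γ`, so only the one-parameter families in `U21` (membership `uᴴ J u = J` from ★ `star_blockBoost_mul_mul_blockBoost` with `H := J`) and the compact
carrier `{h | Ad_h(torusH θ) ∈ tsupport f}` (★ (a1) all-regime support confinement) are new.
* §1 `exists_blockBoost_U21`, `exists_blockRot_U21`: for `(X, P)` with `P² = P`, `PX = XP = X`, `X² = ±P`, `Pᴴ = P`, `PJ = JP`, `XᴴJ = −JX`, the boost `1 + (ch s − 1)P + sh s·X` ∕ rotation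
  `1 + (cos s − 1)P + sin s·X` is a continuous one-parameter family in `U21` (instances: the noncompact root planes `X = E_{p2}+E_{2p}`, `i(E_{p2}−E_{2p})`, `P = E_{pp}+E_{22}` are BOOSTS; the
  compact root plane `X = E₀₁−E₁₀`, `i(E₀₁+E₁₀)`, `P = E₀₀+E₁₁` are ROTATIONS — ★ (a0) `lieBasis 3…8`).
* §2 `isCompact_setOf_conj_torusH_mem_tsupport`: for `f` compactly supported and `θ 0 ≠ θ 2`, `θ 1 ≠ θ 2`, `{h ∈ U21 | Ad_h(torusH θ) ∈ tsupport f}` is compact.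
* §3 **`integral_blockBoostJet_torusH_eq_zero`**, **`integral_blockRotJet_torusH_eq_zero`**: for `μ` finite on compacta and right-invariant, `f ∈ C²_c(M₃(ℂ); E)`, `γ = torusH θ`:
  `∫ [D²f(hγh⁻¹)(h(Xγ − γX)h⁻¹)² + Df(hγh⁻¹)(h(±(Pγ + γP) − 2XγX)h⁻¹)] dμ(h) = 0` (and the integrand is integrable).
HONEST LABEL: HC_CM is proved only modulo the printed citations until rung 0 closes; bookkeeping over ★ A-p18 + ★ (a1), pays nothing by itself.

## References
* [Varadarajan1989] V. S. Varadarajan, *An Introduction to Harmonic Analysis on Semisimple Lie Groups* (1989), §6.3.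
* [WarnerHASSLG2] G. Warner, *Harmonic Analysis on Semi-Simple Lie Groups II*, Grundlehren 189 (1972), §8.4.1.
* [Folland1995] G. B. Folland, *A Course in Abstract Harmonic Analysis* (1995), §2.6.
-/

set_option autoImplicit false

noncomputable section

namespace Literature.Geometry.ComplexHyperbolic

namespace BallModel

open _root_.Complex _root_.Matrix _root_.MeasureTheory _root_.Set _root_.Filter _root_.Topology
open Literature.NumberTheory.Automorphic.RootVectors
open scoped Matrix.Norms.Operator ComplexConjugate

/-! ## §1 Block boosts and rotations as continuous one-parameter families in `U21` -/

section Families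

/-- **The block boost is a continuous one-parameter family in `U21`** (`uᴴ J u = J` by ★ `star_blockBoost_mul_mul_blockBoost` with `H := J`), with values
`u(s) = 1 + (ch s − 1)P + sh s·X` and `u(s)⁻¹ = u(−s)` — A-p18's ★ `exists_blockBoost` for the ball model. [cite: Varadarajan1989, §6.3] -/
theorem exists_blockBoost_U21 (X P : Matrix (Fin 3) (Fin 3) ℂ) (hPP : P * P = P) (hPX : P * X = X) (hXP : X * P = X) (hXX : X * X = P) (hPs : star P = P)
    (hPH : P * J = J * P) (hXH : star X * J = -(J * X)) :
    ∃ U : ℝ → U21, Continuous U ∧ ∀ s : ℝ,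
      ((U s : GL3) : Matrix (Fin 3) (Fin 3) ℂ) = ((1 : Matrix (Fin 3) (Fin 3) ℂ) + (cosh (s : ℂ) - 1) • P + sinh (s : ℂ) • X) ∧
      ((((U s)⁻¹ : U21) : GL3) : Matrix (Fin 3) (Fin 3) ℂ) = ((1 : Matrix (Fin 3) (Fin 3) ℂ) + (cosh (s : ℂ) - 1) • P - sinh (s : ℂ) • X) := by
  have hch : Continuous fun s : ℝ => cosh (s : ℂ) := Complex.continuous_cosh.comp Complex.continuous_ofReal
  have hsh : Continuous fun s : ℝ => sinh (s : ℂ) := Complex.continuous_sinh.comp Complex.continuous_ofReal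
  obtain ⟨u, hu⟩ : ∃ u : ℝ → GL3, u = fun s =>
      ⟨((1 : Matrix (Fin 3) (Fin 3) ℂ) + (cosh (s : ℂ) - 1) • P + sinh (s : ℂ) • X), ((1 : Matrix (Fin 3) (Fin 3) ℂ) + (cosh (s : ℂ) - 1) • P - sinh (s : ℂ) • X),
        blockBoost_mul_blockBoost_neg X P hPP hPX hXP hXX s, blockBoost_neg_mul_blockBoost X P hPP hPX hXP hXX s⟩ := ⟨_, rfl⟩
  have hval : ∀ s, ((u s : GL3) : Matrix (Fin 3) (Fin 3) ℂ) = ((1 : Matrix (Fin 3) (Fin 3) ℂ) + (cosh (s : ℂ) - 1) • P + sinh (s : ℂ) • X) := fun s => by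
    rw [hu]
  have hinv : ∀ s, (((u s)⁻¹ : GL3) : Matrix (Fin 3) (Fin 3) ℂ) = ((1 : Matrix (Fin 3) (Fin 3) ℂ) + (cosh (s : ℂ) - 1) • P - sinh (s : ℂ) • X) := fun s => by
    rw [hu]; rfl
  have hmem : ∀ s, u s ∈ U21 := fun s => by
    show ((u s : GL3) : Matrix (Fin 3) (Fin 3) ℂ)ᴴ * J * ((u s : GL3) : Matrix (Fin 3) (Fin 3) ℂ) = J
    rw [hval, ← Matrix.star_eq_conjTranspose]
    exact star_blockBoost_mul_mul_blockBoost X P hPP hPX hXP hXX _ hXH hPs hPH s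
  have hcont : Continuous u := by
    refine Units.continuous_iff.2 ⟨?_, ?_⟩
    · show Continuous fun s => ((u s : GL3) : Matrix (Fin 3) (Fin 3) ℂ)
      simp_rw [hval]; exact (continuous_const.add ((hch.sub continuous_const).smul continuous_const)).add (hsh.smul continuous_const)
    · simp_rw [hinv]; exact (continuous_const.add ((hch.sub continuous_const).smul continuous_const)).sub (hsh.smul continuous_const)
  refine ⟨fun s => ⟨u s, hmem s⟩, hcont.subtype_mk _, fun s => ⟨hval s, ?_⟩⟩
  rw [← hinv s]
  rfl

/-- **The block rotation is a continuous one-parameter family in `U21`**, values `u(s) = 1 + (cos s − 1)P + sin s·X`, `u(s)⁻¹ = u(−s)` — A-p18's ★ `exists_blockRot` for the ball model.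
[cite: Varadarajan1989, §6.3] -/
theorem exists_blockRot_U21 (X P : Matrix (Fin 3) (Fin 3) ℂ) (hPP : P * P = P) (hPX : P * X = X) (hXP : X * P = X) (hXX : X * X = -P) (hPs : star P = P)
    (hPH : P * J = J * P) (hXH : star X * J = -(J * X)) :
    ∃ U : ℝ → U21, Continuous U ∧ ∀ s : ℝ,
      ((U s : GL3) : Matrix (Fin 3) (Fin 3) ℂ) = ((1 : Matrix (Fin 3) (Fin 3) ℂ) + (Complex.cos (s : ℂ) - 1) • P + Complex.sin (s : ℂ) • X) ∧
      ((((U s)⁻¹ : U21) : GL3) : Matrix (Fin 3) (Fin 3) ℂ) = ((1 : Matrix (Fin 3) (Fin 3) ℂ) + (Complex.cos (s : ℂ) - 1) • P - Complex.sin (s : ℂ) • X) := by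
  have hch : Continuous fun s : ℝ => Complex.cos (s : ℂ) := Complex.continuous_cos.comp Complex.continuous_ofReal
  have hsh : Continuous fun s : ℝ => Complex.sin (s : ℂ) := Complex.continuous_sin.comp Complex.continuous_ofReal
  obtain ⟨u, hu⟩ : ∃ u : ℝ → GL3, u = fun s =>
      ⟨((1 : Matrix (Fin 3) (Fin 3) ℂ) + (Complex.cos (s : ℂ) - 1) • P + Complex.sin (s : ℂ) • X), ((1 : Matrix (Fin 3) (Fin 3) ℂ) + (Complex.cos (s : ℂ) - 1) • P - Complex.sin (s : ℂ) • X),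
        blockRot_mul_blockRot_neg X P hPP hPX hXP hXX s, blockRot_neg_mul_blockRot X P hPP hPX hXP hXX s⟩ := ⟨_, rfl⟩
  have hval : ∀ s, ((u s : GL3) : Matrix (Fin 3) (Fin 3) ℂ) = ((1 : Matrix (Fin 3) (Fin 3) ℂ) + (Complex.cos (s : ℂ) - 1) • P + Complex.sin (s : ℂ) • X) := fun s => by
    rw [hu]
  have hinv : ∀ s, (((u s)⁻¹ : GL3) : Matrix (Fin 3) (Fin 3) ℂ) = ((1 : Matrix (Fin 3) (Fin 3) ℂ) + (Complex.cos (s : ℂ) - 1) • P - Complex.sin (s : ℂ) • X) := fun s => by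
    rw [hu]; rfl
  have hmem : ∀ s, u s ∈ U21 := fun s => by
    show ((u s : GL3) : Matrix (Fin 3) (Fin 3) ℂ)ᴴ * J * ((u s : GL3) : Matrix (Fin 3) (Fin 3) ℂ) = J
    rw [hval, ← Matrix.star_eq_conjTranspose]
    exact star_blockRot_mul_mul_blockRot X P hPP hPX hXP hXX _ hXH hPs hPH s
  have hcont : Continuous u := by
    refine Units.continuous_iff.2 ⟨?_, ?_⟩
    · show Continuous fun s => ((u s : GL3) : Matrix (Fin 3) (Fin 3) ℂ)
      simp_rw [hval]; exact (continuous_const.add ((hch.sub continuous_const).smul continuous_const)).add (hsh.smul continuous_const)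
    · simp_rw [hinv]; exact (continuous_const.add ((hch.sub continuous_const).smul continuous_const)).sub (hsh.smul continuous_const)
  refine ⟨fun s => ⟨u s, hmem s⟩, hcont.subtype_mk _, fun s => ⟨hval s, ?_⟩⟩
  rw [← hinv s]
  rfl

end Families

/-! ## §2 The compact carrier at a Lie-algebra torus point off the noncompact walls -/

section Carrier

/-- **Compact carrier**: for `f` with compact support and `θ 0 ≠ θ 2`, `θ 1 ≠ θ 2`, `{h ∈ U21 | h·torusH θ·h⁻¹ ∈ tsupport f}` is compact — closed, and inside the compact sub-level set
`{‖h₂₂‖² ≤ 1 + 2R²∕m²}` of ★ (a1) `norm_22_sq_le_of_apply_conj_torusH_ne_zero` applied to the indicator-like function `X ↦ if X ∈ tsupport f then 1 else 0`. [cite: WarnerHASSLG2, §8.4.1] -/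
theorem isCompact_setOf_conj_torusH_mem_tsupport {E : Type*} [NormedAddCommGroup E] {f : Matrix (Fin 3) (Fin 3) ℂ → E} (hfc : HasCompactSupport f)
    (θ : Fin 3 → ℝ) (h02 : θ 0 ≠ θ 2) (h12 : θ 1 ≠ θ 2) :
    IsCompact {h : U21 | mat h * torusH θ * mat h⁻¹ ∈ tsupport f} := by
  classical
  -- a radius for `tsupport f`
  obtain ⟨R, hR⟩ : ∃ R : ℝ, ∀ X ∈ tsupport f, ‖X‖ ≤ R := by
    obtain ⟨R, hR⟩ := hfc.isCompact.isBounded.subset_closedBall 0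
    exact ⟨R, fun X hX => by simpa using hR hX⟩
  set m : ℝ := min |θ 0 - θ 2| |θ 1 - θ 2| with hm
  have hmpos : 0 < m := lt_min (abs_pos.2 (sub_ne_zero.2 h02)) (abs_pos.2 (sub_ne_zero.2 h12))
  -- the indicator-like test function `𝟙` of `tsupport f` (values in `ℝ`)
  set g : Matrix (Fin 3) (Fin 3) ℂ → ℝ := fun X => if X ∈ tsupport f then 1 else 0 with hg
  have hgR : ∀ X, g X ≠ 0 → ‖X‖ ≤ R := by
    intro X hX
    by_cases hXs : X ∈ tsupport f
    · exact hR X hXs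
    · exact absurd (by rw [hg]; simp [hXs]) hX
  have hsub : {h : U21 | mat h * torusH θ * mat h⁻¹ ∈ tsupport f} ⊆ {h : U21 | ‖mat h 2 2‖ ^ 2 ≤ 1 + 2 * R ^ 2 / m ^ 2} := by
    intro h hh
    have hh' : mat h * torusH θ * mat h⁻¹ ∈ tsupport f := hh
    have hne : g (mat h * torusH θ * mat h⁻¹) ≠ 0 := by rw [hg]; simp [hh']
    exact norm_22_sq_le_of_apply_conj_torusH_ne_zero hgR hmpos θ le_rfl h hne
  have hclosed : IsClosed {h : U21 | mat h * torusH θ * mat h⁻¹ ∈ tsupport f} :=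
    (isClosed_tsupport f).preimage ((continuous_mat.mul continuous_const).mul (continuous_mat.comp continuous_inv))
  exact (isCompact_setOf_norm_22_sq_le (by positivity)).of_isClosed_subset hclosed hsub

end Carrier

/-! ## §3 The jet identities at `H = torusH θ` -/

section Jets

variable {E : Type*} [NormedAddCommGroup E] [NormedSpace ℝ E] [CompleteSpace E]

/-- **Right-invariance kills the block-boost jets at a Lie-algebra torus point.**  For `μ` finite on compacta and right-invariant on `U21`, `f ∈ C²_c(M₃(ℂ); E)`, a block boost `(X, P)` of
`𝔲(2,1)` (`XᴴJ = −JX`) and `γ = torusH θ` off the noncompact walls: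
`∫ [D²f(hγh⁻¹)(h(Xγ − γX)h⁻¹, h(Xγ − γX)h⁻¹) + Df(hγh⁻¹)(h((Pγ + γP) − 2XγX)h⁻¹)] dμ(h) = 0`, and the integrand is integrable (A-p18's ★ `integral_blockBoostJet_eq_zero`, ball model, Lie algebra).
[cite: Varadarajan1989, §6.3] [cite: Folland1995, §2.6] -/
theorem integral_blockBoostJet_torusH_eq_zero (μ : Measure U21) [IsFiniteMeasureOnCompacts μ] [μ.IsMulRightInvariant]
    (f : Matrix (Fin 3) (Fin 3) ℂ → E) (hf : ContDiff ℝ 2 f) (hfc : HasCompactSupport f)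
    (X P : Matrix (Fin 3) (Fin 3) ℂ) (hPP : P * P = P) (hPX : P * X = X) (hXP : X * P = X) (hXX : X * X = P) (hPs : star P = P)
    (hPH : P * J = J * P) (hXH : star X * J = -(J * X))
    (θ : Fin 3 → ℝ) (h02 : θ 0 ≠ θ 2) (h12 : θ 1 ≠ θ 2) {γ : Matrix (Fin 3) (Fin 3) ℂ} (hγ : γ = torusH θ) :
    Integrable (fun h : U21 =>
        fderiv ℝ (fderiv ℝ f) (((h : GL3) : Matrix (Fin 3) (Fin 3) ℂ) * γ * (((h⁻¹ : U21) : GL3) : Matrix (Fin 3) (Fin 3) ℂ)) (((h : GL3) : Matrix (Fin 3) (Fin 3) ℂ) * (X * γ - γ * X) * (((h⁻¹ : U21) : GL3) : Matrix (Fin 3) (Fin 3) ℂ)) (((h : GL3) : Matrix (Fin 3) (Fin 3) ℂ) * (X * γ - γ * X) * (((h⁻¹ : U21) : GL3) : Matrix (Fin 3) (Fin 3) ℂ)) +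
          fderiv ℝ f (((h : GL3) : Matrix (Fin 3) (Fin 3) ℂ) * γ * (((h⁻¹ : U21) : GL3) : Matrix (Fin 3) (Fin 3) ℂ)) (((h : GL3) : Matrix (Fin 3) (Fin 3) ℂ) * (P * γ + γ * P - (2 : ℂ) • (X * γ * X)) * (((h⁻¹ : U21) : GL3) : Matrix (Fin 3) (Fin 3) ℂ))) μ ∧
      ∫ h : U21, (fderiv ℝ (fderiv ℝ f) (((h : GL3) : Matrix (Fin 3) (Fin 3) ℂ) * γ * (((h⁻¹ : U21) : GL3) : Matrix (Fin 3) (Fin 3) ℂ)) (((h : GL3) : Matrix (Fin 3) (Fin 3) ℂ) * (X * γ - γ * X) * (((h⁻¹ : U21) : GL3) : Matrix (Fin 3) (Fin 3) ℂ)) (((h : GL3) : Matrix (Fin 3) (Fin 3) ℂ) * (X * γ - γ * X) * (((h⁻¹ : U21) : GL3) : Matrix (Fin 3) (Fin 3) ℂ)) +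
          fderiv ℝ f (((h : GL3) : Matrix (Fin 3) (Fin 3) ℂ) * γ * (((h⁻¹ : U21) : GL3) : Matrix (Fin 3) (Fin 3) ℂ)) (((h : GL3) : Matrix (Fin 3) (Fin 3) ℂ) * (P * γ + γ * P - (2 : ℂ) • (X * γ * X)) * (((h⁻¹ : U21) : GL3) : Matrix (Fin 3) (Fin 3) ℂ))) ∂μ = 0 := by
  obtain ⟨U, hUc, hU⟩ := exists_blockBoost_U21 X P hPP hPX hXP hXX hPs hPH hXH
  have hch : Continuous fun s : ℝ => cosh (s : ℂ) := Complex.continuous_cosh.comp Complex.continuous_ofReal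
  have hsh : Continuous fun s : ℝ => sinh (s : ℂ) := Complex.continuous_sinh.comp Complex.continuous_ofReal
  have hup : Continuous fun s : ℝ => ((1 : Matrix (Fin 3) (Fin 3) ℂ) + (cosh (s : ℂ) - 1) • P + sinh (s : ℂ) • X) := (continuous_const.add ((hch.sub continuous_const).smul continuous_const)).add (hsh.smul continuous_const)
  have hum : Continuous fun s : ℝ => ((1 : Matrix (Fin 3) (Fin 3) ℂ) + (cosh (s : ℂ) - 1) • P - sinh (s : ℂ) • X) := (continuous_const.add ((hch.sub continuous_const).smul continuous_const)).sub (hsh.smul continuous_const)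
  have hup' : Continuous fun s : ℝ => (sinh (s : ℂ) • P + cosh (s : ℂ) • X) := (hsh.smul continuous_const).add (hch.smul continuous_const)
  have hum' : Continuous fun s : ℝ => (sinh (s : ℂ) • P - cosh (s : ℂ) • X) := (hsh.smul continuous_const).sub (hch.smul continuous_const)
  have hup'' : Continuous fun s : ℝ => (cosh (s : ℂ) • P + sinh (s : ℂ) • X) := (hch.smul continuous_const).add (hsh.smul continuous_const)
  have hum'' : Continuous fun s : ℝ => (cosh (s : ℂ) • P - sinh (s : ℂ) • X) := (hch.smul continuous_const).sub (hsh.smul continuous_const)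
  -- the conjugation curve and its jets (★ A2)
  obtain ⟨c, hc⟩ : ∃ c : ℝ → Matrix (Fin 3) (Fin 3) ℂ, c = fun s : ℝ => ((1 : Matrix (Fin 3) (Fin 3) ℂ) + (cosh (s : ℂ) - 1) • P + sinh (s : ℂ) • X) * γ * ((1 : Matrix (Fin 3) (Fin 3) ℂ) + (cosh (s : ℂ) - 1) • P - sinh (s : ℂ) • X) := ⟨_, rfl⟩
  obtain ⟨c₁, hc₁⟩ : ∃ c₁ : ℝ → Matrix (Fin 3) (Fin 3) ℂ, c₁ = fun s : ℝ =>
      (sinh (s : ℂ) • P + cosh (s : ℂ) • X) * γ * ((1 : Matrix (Fin 3) (Fin 3) ℂ) + (cosh (s : ℂ) - 1) • P - sinh (s : ℂ) • X) +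
        ((1 : Matrix (Fin 3) (Fin 3) ℂ) + (cosh (s : ℂ) - 1) • P + sinh (s : ℂ) • X) * γ * (sinh (s : ℂ) • P - cosh (s : ℂ) • X) := ⟨_, rfl⟩
  obtain ⟨c₂, hc₂⟩ : ∃ c₂ : ℝ → Matrix (Fin 3) (Fin 3) ℂ, c₂ = fun s : ℝ =>
      ((cosh (s : ℂ) • P + sinh (s : ℂ) • X) * γ * ((1 : Matrix (Fin 3) (Fin 3) ℂ) + (cosh (s : ℂ) - 1) • P - sinh (s : ℂ) • X) +
          (sinh (s : ℂ) • P + cosh (s : ℂ) • X) * γ * (sinh (s : ℂ) • P - cosh (s : ℂ) • X)) +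
        ((sinh (s : ℂ) • P + cosh (s : ℂ) • X) * γ * (sinh (s : ℂ) • P - cosh (s : ℂ) • X) +
          ((1 : Matrix (Fin 3) (Fin 3) ℂ) + (cosh (s : ℂ) - 1) • P + sinh (s : ℂ) • X) * γ * (cosh (s : ℂ) • P - sinh (s : ℂ) • X)) := ⟨_, rfl⟩
  have hcd : ∀ s, HasDerivAt c (c₁ s) s := fun s => by rw [hc, hc₁]; exact hasDerivAt_conjBlockBoost X P γ s
  have hc₁d : ∀ s, HasDerivAt c₁ (c₂ s) s := fun s => by rw [hc₁, hc₂]; exact hasDerivAt_conjBlockBoost_deriv X P γ s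
  have hc₂c : Continuous c₂ := by
    rw [hc₂]
    exact (((hup''.mul continuous_const).mul hum).add ((hup'.mul continuous_const).mul hum')).add
      (((hup'.mul continuous_const).mul hum').add ((hup.mul continuous_const).mul hum''))
  have e0 : c 0 = γ := by rw [hc]; exact conjBlockBoost_zero X P γ
  have e1 : c₁ 0 = X * γ - γ * X := by rw [hc₁]; exact conjBlockBoost_deriv_zero X P γ
  have e2 : c₂ 0 = (P * γ + γ * P - (2 : ℂ) • (X * γ * X)) := by rw [hc₂]; exact conjBlockBoost_deriv_deriv_zero X P γ
  have hconjU : ∀ (h : U21) (s : ℝ),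
      (((h * U s : U21) : GL3) : Matrix (Fin 3) (Fin 3) ℂ) * γ * ((((h * U s)⁻¹ : U21) : GL3) : Matrix (Fin 3) (Fin 3) ℂ) =
        ((h : GL3) : Matrix (Fin 3) (Fin 3) ℂ) * c s * (((h⁻¹ : U21) : GL3) : Matrix (Fin 3) (Fin 3) ℂ) := fun h s => by
    rw [_root_.mul_inv_rev, Subgroup.coe_mul, Subgroup.coe_mul, Units.val_mul, Units.val_mul, (hU s).1, (hU s).2, hc]
    simp only [Matrix.mul_assoc]
  have hK₀ := isCompact_setOf_conj_torusH_mem_tsupport hfc θ h02 h12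
  rw [← hγ] at hK₀
  have h := integral_curveJets_eq_zero U21 μ f hf hUc hcd hc₁d hc₂c e0 hconjU hK₀
  rw [e1, e2] at h
  exact h

/-- **Right-invariance kills the block-rotation jets at a Lie-algebra torus point**: as `integral_blockBoostJet_torusH_eq_zero` with `X² = −P`, `u(s) = 1 + (cos s − 1)P + sin s·X` and second
jet `−(Pγ + γP) − 2XγX`. [cite: Varadarajan1989, §6.3] [cite: Folland1995, §2.6] -/
theorem integral_blockRotJet_torusH_eq_zero (μ : Measure U21) [IsFiniteMeasureOnCompacts μ] [μ.IsMulRightInvariant]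
    (f : Matrix (Fin 3) (Fin 3) ℂ → E) (hf : ContDiff ℝ 2 f) (hfc : HasCompactSupport f)
    (X P : Matrix (Fin 3) (Fin 3) ℂ) (hPP : P * P = P) (hPX : P * X = X) (hXP : X * P = X) (hXX : X * X = -P) (hPs : star P = P)
    (hPH : P * J = J * P) (hXH : star X * J = -(J * X))
    (θ : Fin 3 → ℝ) (h02 : θ 0 ≠ θ 2) (h12 : θ 1 ≠ θ 2) {γ : Matrix (Fin 3) (Fin 3) ℂ} (hγ : γ = torusH θ) :
    Integrable (fun h : U21 =>
        fderiv ℝ (fderiv ℝ f) (((h : GL3) : Matrix (Fin 3) (Fin 3) ℂ) * γ * (((h⁻¹ : U21) : GL3) : Matrix (Fin 3) (Fin 3) ℂ)) (((h : GL3) : Matrix (Fin 3) (Fin 3) ℂ) * (X * γ - γ * X) * (((h⁻¹ : U21) : GL3) : Matrix (Fin 3) (Fin 3) ℂ)) (((h : GL3) : Matrix (Fin 3) (Fin 3) ℂ) * (X * γ - γ * X) * (((h⁻¹ : U21) : GL3) : Matrix (Fin 3) (Fin 3) ℂ)) +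
          fderiv ℝ f (((h : GL3) : Matrix (Fin 3) (Fin 3) ℂ) * γ * (((h⁻¹ : U21) : GL3) : Matrix (Fin 3) (Fin 3) ℂ)) (((h : GL3) : Matrix (Fin 3) (Fin 3) ℂ) * (-(P * γ + γ * P) - (2 : ℂ) • (X * γ * X)) * (((h⁻¹ : U21) : GL3) : Matrix (Fin 3) (Fin 3) ℂ))) μ ∧
      ∫ h : U21, (fderiv ℝ (fderiv ℝ f) (((h : GL3) : Matrix (Fin 3) (Fin 3) ℂ) * γ * (((h⁻¹ : U21) : GL3) : Matrix (Fin 3) (Fin 3) ℂ)) (((h : GL3) : Matrix (Fin 3) (Fin 3) ℂ) * (X * γ - γ * X) * (((h⁻¹ : U21) : GL3) : Matrix (Fin 3) (Fin 3) ℂ)) (((h : GL3) : Matrix (Fin 3) (Fin 3) ℂ) * (X * γ - γ * X) * (((h⁻¹ : U21) : GL3) : Matrix (Fin 3) (Fin 3) ℂ)) +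
          fderiv ℝ f (((h : GL3) : Matrix (Fin 3) (Fin 3) ℂ) * γ * (((h⁻¹ : U21) : GL3) : Matrix (Fin 3) (Fin 3) ℂ)) (((h : GL3) : Matrix (Fin 3) (Fin 3) ℂ) * (-(P * γ + γ * P) - (2 : ℂ) • (X * γ * X)) * (((h⁻¹ : U21) : GL3) : Matrix (Fin 3) (Fin 3) ℂ))) ∂μ = 0 := by
  obtain ⟨U, hUc, hU⟩ := exists_blockRot_U21 X P hPP hPX hXP hXX hPs hPH hXH
  have hch : Continuous fun s : ℝ => Complex.cos (s : ℂ) := Complex.continuous_cos.comp Complex.continuous_ofReal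
  have hsh : Continuous fun s : ℝ => Complex.sin (s : ℂ) := Complex.continuous_sin.comp Complex.continuous_ofReal
  have hup : Continuous fun s : ℝ => ((1 : Matrix (Fin 3) (Fin 3) ℂ) + (Complex.cos (s : ℂ) - 1) • P + Complex.sin (s : ℂ) • X) := (continuous_const.add ((hch.sub continuous_const).smul continuous_const)).add (hsh.smul continuous_const)
  have hum : Continuous fun s : ℝ => ((1 : Matrix (Fin 3) (Fin 3) ℂ) + (Complex.cos (s : ℂ) - 1) • P - Complex.sin (s : ℂ) • X) := (continuous_const.add ((hch.sub continuous_const).smul continuous_const)).sub (hsh.smul continuous_const)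
  have hup' : Continuous fun s : ℝ => ((-(Complex.sin (s : ℂ))) • P + Complex.cos (s : ℂ) • X) := (hsh.neg.smul continuous_const).add (hch.smul continuous_const)
  have hum' : Continuous fun s : ℝ => ((-(Complex.sin (s : ℂ))) • P - Complex.cos (s : ℂ) • X) := (hsh.neg.smul continuous_const).sub (hch.smul continuous_const)
  have hup'' : Continuous fun s : ℝ => ((-(Complex.cos (s : ℂ))) • P + (-(Complex.sin (s : ℂ))) • X) := (hch.neg.smul continuous_const).add (hsh.neg.smul continuous_const)
  have hum'' : Continuous fun s : ℝ => ((-(Complex.cos (s : ℂ))) • P - (-(Complex.sin (s : ℂ))) • X) := (hch.neg.smul continuous_const).sub (hsh.neg.smul continuous_const)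
  -- the conjugation curve and its jets (★ A2)
  obtain ⟨c, hc⟩ : ∃ c : ℝ → Matrix (Fin 3) (Fin 3) ℂ, c = fun s : ℝ => ((1 : Matrix (Fin 3) (Fin 3) ℂ) + (Complex.cos (s : ℂ) - 1) • P + Complex.sin (s : ℂ) • X) * γ * ((1 : Matrix (Fin 3) (Fin 3) ℂ) + (Complex.cos (s : ℂ) - 1) • P - Complex.sin (s : ℂ) • X) := ⟨_, rfl⟩
  obtain ⟨c₁, hc₁⟩ : ∃ c₁ : ℝ → Matrix (Fin 3) (Fin 3) ℂ, c₁ = fun s : ℝ =>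
      ((-(Complex.sin (s : ℂ))) • P + Complex.cos (s : ℂ) • X) * γ * ((1 : Matrix (Fin 3) (Fin 3) ℂ) + (Complex.cos (s : ℂ) - 1) • P - Complex.sin (s : ℂ) • X) +
        ((1 : Matrix (Fin 3) (Fin 3) ℂ) + (Complex.cos (s : ℂ) - 1) • P + Complex.sin (s : ℂ) • X) * γ * ((-(Complex.sin (s : ℂ))) • P - Complex.cos (s : ℂ) • X) := ⟨_, rfl⟩
  obtain ⟨c₂, hc₂⟩ : ∃ c₂ : ℝ → Matrix (Fin 3) (Fin 3) ℂ, c₂ = fun s : ℝ =>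
      (((-(Complex.cos (s : ℂ))) • P + (-(Complex.sin (s : ℂ))) • X) * γ * ((1 : Matrix (Fin 3) (Fin 3) ℂ) + (Complex.cos (s : ℂ) - 1) • P - Complex.sin (s : ℂ) • X) +
          ((-(Complex.sin (s : ℂ))) • P + Complex.cos (s : ℂ) • X) * γ * ((-(Complex.sin (s : ℂ))) • P - Complex.cos (s : ℂ) • X)) +
        (((-(Complex.sin (s : ℂ))) • P + Complex.cos (s : ℂ) • X) * γ * ((-(Complex.sin (s : ℂ))) • P - Complex.cos (s : ℂ) • X) +
          ((1 : Matrix (Fin 3) (Fin 3) ℂ) + (Complex.cos (s : ℂ) - 1) • P + Complex.sin (s : ℂ) • X) * γ * ((-(Complex.cos (s : ℂ))) • P - (-(Complex.sin (s : ℂ))) • X)) := ⟨_, rfl⟩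
  have hcd : ∀ s, HasDerivAt c (c₁ s) s := fun s => by rw [hc, hc₁]; exact hasDerivAt_conjBlockRot X P γ s
  have hc₁d : ∀ s, HasDerivAt c₁ (c₂ s) s := fun s => by rw [hc₁, hc₂]; exact hasDerivAt_conjBlockRot_deriv X P γ s
  have hc₂c : Continuous c₂ := by
    rw [hc₂]
    exact (((hup''.mul continuous_const).mul hum).add ((hup'.mul continuous_const).mul hum')).add
      (((hup'.mul continuous_const).mul hum').add ((hup.mul continuous_const).mul hum''))
  have e0 : c 0 = γ := by rw [hc]; exact conjBlockRot_zero X P γ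
  have e1 : c₁ 0 = X * γ - γ * X := by rw [hc₁]; exact conjBlockRot_deriv_zero X P γ
  have e2 : c₂ 0 = (-(P * γ + γ * P) - (2 : ℂ) • (X * γ * X)) := by rw [hc₂]; exact conjBlockRot_deriv_deriv_zero X P γ
  have hconjU : ∀ (h : U21) (s : ℝ),
      (((h * U s : U21) : GL3) : Matrix (Fin 3) (Fin 3) ℂ) * γ * ((((h * U s)⁻¹ : U21) : GL3) : Matrix (Fin 3) (Fin 3) ℂ) =
        ((h : GL3) : Matrix (Fin 3) (Fin 3) ℂ) * c s * (((h⁻¹ : U21) : GL3) : Matrix (Fin 3) (Fin 3) ℂ) := fun h s => by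
    rw [_root_.mul_inv_rev, Subgroup.coe_mul, Subgroup.coe_mul, Units.val_mul, Units.val_mul, (hU s).1, (hU s).2, hc]
    simp only [Matrix.mul_assoc]
  have hK₀ := isCompact_setOf_conj_torusH_mem_tsupport hfc θ h02 h12
  rw [← hγ] at hK₀
  have h := integral_curveJets_eq_zero U21 μ f hf hUc hcd hc₁d hc₂c e0 hconjU hK₀
  rw [e1, e2] at h
  exact h

end Jets

end BallModel

end Literature.Geometry.ComplexHyperbolic

end
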